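import Literature.Analysis.FluidPDE.SereginSverak2002PressureLowerBoundProofs
import Literature.Analysis.FluidPDE.SereginSverak2002ACriterion
import HarnessLib

/-!
# Seregin–Šverák 2002: the main theorem reduced to the decay of `A` at top points

Analysis/FluidPDE proofs file (theorems only; no definition, no named fact, no `sorry`) on the
discharge path of the named fact `Literature.Analysis.FluidPDE.SereginSverak2002_pressureOneSidedBound`
(`SereginSverak2002PressureLowerBound.lean`; G. Seregin, V. Šverák, *Navier–Stokes equations
with lower bounds on the pressure*, Arch. Ration. Mech. Anal. **163** (2002) 65–86, Thm. 2.2 with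
the constant majorant `g ≡ M`; the text is cite-only on this hub, acquisition `acq-01580`).

The paper's §1 (p. 66) outlines the proof: "The key is the following identity:
`∫_{B(x₀,r)} |y - x₀|⁻¹ (2p + |P̂_{x₀}u|²) dy = r⁻¹ ∫_{B(x₀,r)} (3p + |u|²) dy
 = r² ∫_{ℝ³ \ B(x₀,r)} ∇²_y(|y - x₀|⁻¹) : (u ⊗ u) dy`,
where `P̂_{x₀}u` is the orthogonal projection of `u` into the two-dimensional subspace of `ℝ³`
perpendicular to `x - x₀` … under our assumptions the above identity gives estimates which move
the equation from the realm of 'super-critical' to the realm of 'critical'." On the tree this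
critical (Type I in `A`) estimate is `SereginSverak2002.ae_energy_ball_le`
(`SereginSverakPressureTypeI.lean`), and the paper's ε-regularity Lemma 3.3 (the `A`-criterion)
is `SereginSverak2002.lemma33` / `isBackwardBoundedAt_of_cknAEss_le`
(`SereginSverak2002ACriterion.lean`). What §4 of the paper supplies on top of these — that at a
point of the FINAL slice the scaled energy `A(r; (T, x₀))` actually becomes small as `r → 0` — is
the one remaining analytic input. This file records, sorry-free, that it is exactly what is
missing:

* `SereginSverak2002.cknA_le_of_norm_le` — a pointwise bound `|u| ≤ C` on the backward cylinder
  `(t₀ - r₀², t₀) × B(x₀, r₀)` gives `A(r; (t₀, x₀)) ≤ 5 C² r²` for `0 < r ≤ r₀`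
  (`|B_r| = (4π/3) r³ ≤ 5 r³`);
* `SereginSverak2002.cknAEss_small_of_isBackwardBoundedAt` — hence backward boundedness at
  `(t₀, x₀)` forces `A(r; (t₀, x₀)) → 0`: for every `ε > 0`, `A(r) ≤ ε` for all small `r`;
* `SereginSverak2002_pressureOneSidedBound.of_cknAEss_small` — **the reduction**: the fact follows
  from the statement "under the hypotheses of the fact with `ν = 1`, at every top point `(T, x₀)`
  and for every `ε > 0`, `ess sup_{T-r²<s<T} r⁻¹∫_{B_r(x₀)}|u(s)|² ≤ ε` for all `0 < r < R(ε)`"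
  (unit viscosity by `of_unitViscosity`; interior times `t₀ < T` by continuity of the classical
  solution, `IsBackwardBoundedAt.of_continuousOn`; the top time by Lemma 3.3,
  `isBackwardBoundedAt_of_cknAEss_le`);
* `SereginSverak2002_pressureOneSidedBound.iff_cknAEss_small` — and conversely the fact implies
  that statement, so the two are EQUIVALENT: the named fact is precisely the assertion that the
  scaled kinetic energy decays at every point of the final slice.

Nothing here is the missing §4 argument itself; the equivalence only certifies that the tree's
reductions (viscosity, final time, gauge, Lemma 3.3) compose, and pins the remaining obligation to
a single scale-invariant smallness statement about `A` at top points.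

## References

* G. Seregin, V. Šverák, Arch. Ration. Mech. Anal. 163 (2002) 65–86: abstract, §1 (pp. 65–66,
  the key identity and the outline), Lemma 3.3. [SereginSverak2002]
* T. Barker, W. Wang, J. Differential Equations (2023) = arXiv:2111.15444, §3 Lemma 1 (verbatim
  restatement of Lemma 3.3). [BarkerWang2023]
-/

noncomputable section

open _root_.MeasureTheory Set Function Filter _root_.Topology TopologicalSpace Metric
open scoped NNReal ENNReal

namespace Literature.Analysis.FluidPDE

namespace SereginSverak2002

/-! ## A pointwise bound on a backward cylinder makes `A` small -/

/-- **`A` under a pointwise bound.** If `‖u(t, x)‖ ≤ C` for `t ∈ (t₀ - r₀², t₀)`, `x ∈ B(x₀, r₀)`,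
then for `0 < r ≤ r₀` the scaled energy satisfies `A(r; (t₀, x₀)) ≤ 5 C² r²`
(`r⁻¹ ∫_{B_r} C² = C² |B₁| r² ≤ 5 C² r²`). [folklore] -/
theorem cknA_le_of_norm_le {u : ℝ → EuclideanSpace ℝ (Fin 3) → EuclideanSpace ℝ (Fin 3)} {t₀ : ℝ} {x₀ : EuclideanSpace ℝ (Fin 3)} {r₀ C r : ℝ}
    (hC : ∀ t ∈ Ioo (t₀ - r₀ ^ 2) t₀, ∀ x ∈ ball x₀ r₀, ‖u t x‖ ≤ C)
    (hr : 0 < r) (hrr : r ≤ r₀) :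
    cknA r (t₀, x₀) u ≤ ENNReal.ofReal (5 * C ^ 2 * r ^ 2) := by
  have hC0 : 0 ≤ C := by
    have ht : t₀ - r ^ 2 / 2 ∈ Ioo (t₀ - r₀ ^ 2) t₀ := by
      have h1 : r ^ 2 ≤ r₀ ^ 2 := pow_le_pow_left₀ hr.le hrr 2
      constructor <;> nlinarith [sq_pos_of_pos hr]
    exact (norm_nonneg _).trans (hC _ ht x₀ (mem_ball_self (hr.trans_le hrr)))
  unfold cknA
  refine iSup₂_le fun t ht => ?_
  have ht' : t ∈ Ioo (t₀ - r₀ ^ 2) t₀ := by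
    have h1 : r ^ 2 ≤ r₀ ^ 2 := pow_le_pow_left₀ hr.le hrr 2
    exact ⟨by linarith [ht.1], ht.2⟩
  -- the slice integral is at most `C² |B_r| ≤ 5 C² r³`
  have hvol : volume (ball x₀ r) ≤ ENNReal.ofReal (5 * r ^ 3) := by
    rw [EuclideanSpace.volume_ball_fin_three, ← ENNReal.ofReal_pow hr.le,
      ← ENNReal.ofReal_mul (by positivity)]
    refine ENNReal.ofReal_le_ofReal ?_
    have := Real.pi_lt_d2
    nlinarith [pow_pos hr 3]
  have hint : ∫⁻ x in ball x₀ r, ‖u t x‖ₑ ^ 2 ≤ ENNReal.ofReal (C ^ 2) * volume (ball x₀ r) := by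
    calc ∫⁻ x in ball x₀ r, ‖u t x‖ₑ ^ 2 ≤ ∫⁻ _ in ball x₀ r, ENNReal.ofReal (C ^ 2) := by
          refine setLIntegral_mono measurable_const fun x hx => ?_
          have h1 : ‖u t x‖ ≤ C := hC t ht' x (ball_subset_ball hrr hx)
          have h2 : ‖u t x‖ₑ = ENNReal.ofReal ‖u t x‖ := (ofReal_norm (u t x)).symm
          rw [h2, ← ENNReal.ofReal_pow (norm_nonneg _)]
          exact ENNReal.ofReal_le_ofReal (pow_le_pow_left₀ (norm_nonneg _) h1 2)
      _ = ENNReal.ofReal (C ^ 2) * volume (ball x₀ r) := by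
          rw [setLIntegral_const]
  calc (ENNReal.ofReal r)⁻¹ * ∫⁻ x in ball x₀ r, ‖u t x‖ₑ ^ 2
      ≤ (ENNReal.ofReal r)⁻¹ * (ENNReal.ofReal (C ^ 2) * ENNReal.ofReal (5 * r ^ 3)) := by
        gcongr
        exact hint.trans (by gcongr)
    _ = ENNReal.ofReal (5 * C ^ 2 * r ^ 2) := by
        rw [← ENNReal.ofReal_inv_of_pos hr, ← ENNReal.ofReal_mul (by positivity),
          ← ENNReal.ofReal_mul (by positivity)]
        congr 1
        field_simp

/-- **Backward boundedness forces `A → 0`.** If `u` is bounded on some backward cylinder at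
`(t₀, x₀)` (`IsBackwardBoundedAt`), then for every `ε > 0` there is `R > 0` with
`A(r; (t₀, x₀)) ≤ ε` — in the essential form `cknAEss ≤ cknA` — for all `0 < r < R`. [folklore] -/
theorem cknAEss_small_of_isBackwardBoundedAt {u : ℝ → EuclideanSpace ℝ (Fin 3) → EuclideanSpace ℝ (Fin 3)} {t₀ : ℝ} {x₀ : EuclideanSpace ℝ (Fin 3)}
    (h : IsBackwardBoundedAt u t₀ x₀) {ε : ℝ} (hε : 0 < ε) :
    ∃ R : ℝ, 0 < R ∧ ∀ r ∈ Ioo 0 R, cknAEss r (t₀, x₀) u ≤ ENNReal.ofReal ε := by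
  obtain ⟨r₀, hr₀, C, hC⟩ := h
  -- `R = min r₀ √(ε / (5 C² + 1))`
  set K : ℝ := 5 * C ^ 2 + 1 with hK
  have hK0 : 0 < K := by positivity
  refine ⟨min r₀ (Real.sqrt (ε / K)), lt_min hr₀ (Real.sqrt_pos.2 (div_pos hε hK0)), ?_⟩
  intro r hr
  have hr0 : 0 < r := hr.1
  have hrr : r ≤ r₀ := hr.2.le.trans (min_le_left _ _)
  have hrs : r ≤ Real.sqrt (ε / K) := hr.2.le.trans (min_le_right _ _)
  have hr2 : r ^ 2 ≤ ε / K := by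
    calc r ^ 2 ≤ Real.sqrt (ε / K) ^ 2 := pow_le_pow_left₀ hr0.le hrs 2
      _ = ε / K := Real.sq_sqrt (div_pos hε hK0).le
  refine cknAEss_le_cknA.trans ((cknA_le_of_norm_le hC hr0 hrr).trans (ENNReal.ofReal_le_ofReal ?_))
  calc 5 * C ^ 2 * r ^ 2 ≤ K * r ^ 2 := by gcongr; linarith
    _ ≤ K * (ε / K) := by gcongr
    _ = ε := mul_div_cancel₀ ε hK0.ne'

/-! ## The reduction of the fact to the decay of `A` at top points -/

/-- **Seregin–Šverák 2002, Thm. 2.2 (constant majorant) reduced to its §4 input.** The named fact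
`SereginSverak2002_pressureOneSidedBound` follows from: for every classical solution `(u, p)` of
the unforced Navier–Stokes system with viscosity `1` on `[0, T) × ℝ³` which is Leray–Hopf on
`[0, T)` with smooth rapidly decaying datum and satisfies one of the two one-sided bounds of the
fact on `(0, T) × ℝ³`, at every top point `(T, x₀)` the scaled energy decays —
for every `ε > 0`, `ess sup_{T-r²<s<T} r⁻¹ ∫_{B_r(x₀)} |u(s)|² ≤ ε` for all `0 < r < R(ε)`.
Proof: reduce to `ν = 1` (`of_unitViscosity`); interior times `t₀ < T` are regular by continuity
of the classical solution (`IsBackwardBoundedAt.of_continuousOn`); at `t₀ = T` apply the paper's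
Lemma 3.3 in the form `isBackwardBoundedAt_of_cknAEss_le` with its universal `ε`.
[cite: SereginSverak2002, §1 p. 66 (outline) and Lemma 3.3] -/
theorem _root_.Literature.Analysis.FluidPDE.SereginSverak2002_pressureOneSidedBound.of_cknAEss_small
    (h : ∀ (T : ℝ) (u : ℝ → EuclideanSpace ℝ (Fin 3) → EuclideanSpace ℝ (Fin 3)) (p : ℝ → EuclideanSpace ℝ (Fin 3) → ℝ), 0 < T →
      IsClassicalNSSolutionOn (Ico 0 T) 1 0 u p → IsLerayHopfOn T 1 0 (u 0) u →
      HasRapidSpatialDecay (u 0) →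
      (∃ M : ℝ, (∀ t ∈ Ioo 0 T, ∀ x, -M ≤ normalisedPressure (u t) x) ∨
        (∀ t ∈ Ioo 0 T, ∀ x, ‖u t x‖ ^ 2 + 2 * normalisedPressure (u t) x ≤ M)) →
      ∀ (x₀ : EuclideanSpace ℝ (Fin 3)) (ε : ℝ), 0 < ε →
        ∃ R : ℝ, 0 < R ∧ ∀ r ∈ Ioo 0 R, cknAEss r (T, x₀) u ≤ ENNReal.ofReal ε) :
    SereginSverak2002_pressureOneSidedBound := by
  refine SereginSverak2002_pressureOneSidedBound.of_unitViscosity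
    fun T hT u p hs hLH hd hM t₀ ht₀ x₀ => ?_
  rcases ht₀.2.lt_or_eq with hlt | rfl
  · exact IsBackwardBoundedAt.of_continuousOn hs.smooth_velocity.continuousOn ⟨ht₀.1, hlt⟩ x₀
  · obtain ⟨ε, hε, h33⟩ := isBackwardBoundedAt_of_cknAEss_le
    obtain ⟨R, hR, hA⟩ := h t₀ u p hT hs hLH hd hM x₀ ε hε
    exact h33 t₀ u p hT hs hLH x₀ R hR hA

/-- **The equivalence.** `SereginSverak2002_pressureOneSidedBound` holds if and only if, for the
`ν = 1` class of the fact, the scaled kinetic energy decays at every top point: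
`∀ ε > 0, ∃ R > 0, ∀ r ∈ (0, R), ess sup_{T-r²<s<T} r⁻¹ ∫_{B_r(x₀)} |u(s)|² ≤ ε`. The forward
direction is `cknAEss_small_of_isBackwardBoundedAt` (a bounded backward cylinder gives
`A(r) ≤ 5C²r²`); the reverse is `of_cknAEss_small`. [cite: SereginSverak2002, §1 p. 66 and Lemma 3.3] -/
theorem _root_.Literature.Analysis.FluidPDE.SereginSverak2002_pressureOneSidedBound.iff_cknAEss_small :
    SereginSverak2002_pressureOneSidedBound ↔
      ∀ (T : ℝ) (u : ℝ → EuclideanSpace ℝ (Fin 3) → EuclideanSpace ℝ (Fin 3)) (p : ℝ → EuclideanSpace ℝ (Fin 3) → ℝ), 0 < T →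
        IsClassicalNSSolutionOn (Ico 0 T) 1 0 u p → IsLerayHopfOn T 1 0 (u 0) u →
        HasRapidSpatialDecay (u 0) →
        (∃ M : ℝ, (∀ t ∈ Ioo 0 T, ∀ x, -M ≤ normalisedPressure (u t) x) ∨
          (∀ t ∈ Ioo 0 T, ∀ x, ‖u t x‖ ^ 2 + 2 * normalisedPressure (u t) x ≤ M)) →
        ∀ (x₀ : EuclideanSpace ℝ (Fin 3)) (ε : ℝ), 0 < ε →
          ∃ R : ℝ, 0 < R ∧ ∀ r ∈ Ioo 0 R, cknAEss r (T, x₀) u ≤ ENNReal.ofReal ε := by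
  refine ⟨fun hfact T u p hT hs hLH hd hM x₀ ε hε => ?_,
    SereginSverak2002_pressureOneSidedBound.of_cknAEss_small⟩
  exact cknAEss_small_of_isBackwardBoundedAt
    (hfact 1 T one_pos hT u p hs hLH hd hM T ⟨hT, le_rfl⟩ x₀) hε

end SereginSverak2002

end Literature.Analysis.FluidPDE
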